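import Mathlib.FieldTheory.PurelyInseparable.PerfectClosure
import Mathlib.FieldTheory.SeparablyGenerated
import Mathlib.RingTheory.Smooth.Field
import Mathlib.FieldTheory.IsAlgClosed.AlgebraicClosure
import Mathlib.FieldTheory.IntermediateField.Adjoin.Algebra
import HarnessLib

/-!
# Separating transcendence bases after a finite purely inseparable extension of the constants

Auxiliary field theory for Temkin's inseparable local uniformization
(`Literature/AlgebraicGeometry/Resolution/LocalUniformization.lean`, fact `Temkin2013`, and its
companion `InseparableLocalUniformization.lean`). In the proof of Temkin 2013, Thm. 4.1.1
(arXiv:0804.1554v3, p. 47) the height-zero case of Thm. 1.3.2 — the trivial valuation — is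
dismissed in one sentence: "the case of valued fields of height zero reduces to the classical
theorem on the existence of a separating transcendence basis". Mathlib has that classical
theorem over a *perfect* ground field (`exists_isTranscendenceBasis_and_isSeparable_of_perfectField`
in `Mathlib.FieldTheory.SeparablyGenerated`). This file descends it to an *arbitrary* ground
field `k` at the price of a finite purely inseparable extension of `k` — which is exactly the
form in which Thm. 1.3.2 consumes it (the finite purely inseparable extensions `l/k` and
`L/lK` of its statement): apply the perfect-field theorem over the perfect closure `k^{perf}`
of `k` inside a perfect field `Ω ⊇ K`, and observe that only finitely many elements of
`k^{perf}` are involved (coefficients of minimal polynomials and of the rational expressions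
for the transcendence basis).

## Main results (all proved)

* `isSeparable_of_ringHom_comp_eq`, `isSeparable_of_le` — separability of an element is
  preserved when the base field is enlarged along a compatible ring homomorphism.
* `exists_finset_isSeparable_of_isSeparable_adjoin` — finite descent of separability: an
  element separable over `F(S)` is separable over `F(T)` for some finite `T ⊆ S`.
* `exists_finset_separatingTranscendenceBasis` — for `Ω ⊇ k` perfect and `T ⊆ Ω` finite there
  are finite sets `C ⊆ k^{perf}` and `s ⊆ k(C, T)`, `s` algebraically independent over `k(C)`,
  with every element of `T` separable over `k(C, s)`.
* `exists_purelyInseparable_isSeparablyGenerated` — for `K/k` finitely generated there are a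
  finite purely inseparable extension `L/K` and an intermediate field `l` of `L/k`, finite and
  purely inseparable over `k`, with `L = lK`, `L/l` separably generated, and hence
  `Algebra.FormallySmooth l L` (Mathlib's
  `Algebra.FormallySmooth.of_algebraicIndependent_of_isSeparable`).

## References

* M. Temkin, *Inseparable local uniformization*, J. Algebra 373 (2013), 65–119
  (arXiv:0804.1554v3), proof of Thm. 4.1.1, p. 47. [cite: Temkin2013, §4.1, p. 47]
* The classical theorem (finitely generated extensions of a perfect field are separably
  generated): Mathlib, `Mathlib.FieldTheory.SeparablyGenerated`.
-/

noncomputable section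

open IntermediateField Polynomial

namespace Literature.AlgebraicGeometry.Resolution

universe u

/-! ## Changing the base field of a separable element along a ring homomorphism -/

/-- If `x ∈ E` is separable over `F₁` and `f : F₁ → F₂` is a ring homomorphism compatible with the
structure maps to `E`, then `x` is separable over `F₂` (its minimal polynomial over `F₂` divides
the image of the one over `F₁`). [folklore] -/
theorem isSeparable_of_ringHom_comp_eq {F₁ F₂ E : Type*} [Field F₁] [Field F₂] [Ring E]
    [Algebra F₁ E] [Algebra F₂ E] (f : F₁ →+* F₂)
    (hf : (algebraMap F₂ E).comp f = algebraMap F₁ E) {x : E} (h : IsSeparable F₁ x) :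
    IsSeparable F₂ x := by
  have hdvd : minpoly F₂ x ∣ (minpoly F₁ x).map f := by
    refine minpoly.dvd F₂ x ?_
    rw [Polynomial.aeval_def, Polynomial.eval₂_map, hf, ← Polynomial.aeval_def, minpoly.aeval]
  exact Polynomial.Separable.of_dvd (Polynomial.Separable.map (show (minpoly F₁ x).Separable from h))
    hdvd

/-- Separability over an intermediate field persists over any larger intermediate field.
[folklore] -/
theorem isSeparable_of_le {F Ω : Type*} [Field F] [Field Ω] [Algebra F Ω]
    {E E' : IntermediateField F Ω} (hle : E ≤ E') {x : Ω} (hx : IsSeparable E x) :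
    IsSeparable E' x :=
  isSeparable_of_ringHom_comp_eq (inclusion hle).toRingHom (RingHom.ext fun _ => rfl) hx

/-- **Finite descent of separability**: if `x` is separable over `F(S)`, then it is separable over
`F(T)` for some finite `T ⊆ S` (the coefficients of the minimal polynomial involve finitely many
elements of `S`). [folklore] -/
theorem exists_finset_isSeparable_of_isSeparable_adjoin {F Ω : Type*} [Field F] [Field Ω]
    [Algebra F Ω] {S : Set Ω} {x : Ω} (hx : IsSeparable (adjoin F S) x) :
    ∃ T : Finset Ω, (T : Set Ω) ⊆ S ∧ IsSeparable (adjoin F (T : Set Ω)) x := by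
  classical
  set q : Polynomial (adjoin F S) := minpoly (adjoin F S) x with hq
  choose T hTS hTmem using fun i : ℕ => exists_finset_of_mem_adjoin (q.coeff i).2
  set T' : Finset Ω := q.support.biUnion T with hT'
  have hT'S : (T' : Set Ω) ⊆ S := by
    intro y hy
    obtain ⟨i, -, hyi⟩ := Finset.mem_biUnion.mp (Finset.mem_coe.mp hy)
    exact hTS i hyi
  have hle : ∀ i ∈ q.support, adjoin F (T i : Set Ω) ≤ adjoin F (T' : Set Ω) := fun i hi =>
    adjoin.mono F _ _ fun y hy =>
      Finset.mem_coe.mpr (Finset.mem_biUnion.mpr ⟨i, hi, Finset.mem_coe.mp hy⟩)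
  have hleS : adjoin F (T' : Set Ω) ≤ adjoin F S := adjoin.mono F _ _ hT'S
  let f : adjoin F (T' : Set Ω) →+* adjoin F S := (inclusion hleS).toRingHom
  have hf : (algebraMap (adjoin F S) Ω).comp f = algebraMap (adjoin F (T' : Set Ω)) Ω :=
    RingHom.ext fun _ => rfl
  have hlift : q ∈ Polynomial.lifts f := by
    rw [Polynomial.lifts_iff_coeff_lifts]
    intro n
    by_cases hn : n ∈ q.support
    · exact ⟨⟨(q.coeff n : Ω), hle n hn (hTmem n)⟩, Subtype.ext rfl⟩
    · have h0 : q.coeff n = 0 := by simpa [Polynomial.mem_support_iff] using hn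
      exact ⟨0, by rw [h0, map_zero]⟩
  obtain ⟨q', hq'⟩ := (Polynomial.mem_lifts q).mp hlift
  have haeval : Polynomial.aeval x q' = 0 := by
    rw [Polynomial.aeval_def, ← hf, ← Polynomial.eval₂_map, hq', ← Polynomial.aeval_def, hq,
      minpoly.aeval]
  have hsep' : q'.Separable := by
    rw [← Polynomial.separable_map f, hq']
    exact hx
  exact ⟨T', hT'S, Polynomial.Separable.of_dvd hsep' (minpoly.dvd _ x haeval)⟩

/-! ## The separating transcendence basis after a finite purely inseparable extension -/

/-- **Separating transcendence bases after finitely many `p`-power roots of constants.** Let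
`Ω ⊇ k` be a perfect field and `T ⊆ Ω` finite. Then there are a finite set `C ⊆ Ω` of elements
purely inseparable over `k` (i.e. `C ⊆` the perfect closure of `k` in `Ω`) and a finite set
`s ⊆ k(C, T)`, algebraically independent over `k(C)`, such that every element of `T` is separable
over `k(C, s)`; in words: `k(C)(T) / k(C)` is separably generated, with separating transcendence
basis `s`. Proof: `k^{perf}(T) / k^{perf}` is separably generated because `k^{perf}` (the perfect
closure of `k` in `Ω`) is perfect (Mathlib's
`exists_isTranscendenceBasis_and_isSeparable_of_perfectField`); the finitely many elements of
`k^{perf}` involved generate a finite purely inseparable extension `k(C)`. [folklore] -/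
theorem exists_finset_separatingTranscendenceBasis (k Ω : Type*) [Field k] [Field Ω] [Algebra k Ω]
    [PerfectField Ω] (T : Finset Ω) :
    ∃ C s : Finset Ω, (C : Set Ω) ⊆ perfectClosure k Ω ∧
      (s : Set Ω) ⊆ adjoin k ((C : Set Ω) ∪ T) ∧
      AlgebraicIndependent (adjoin k (C : Set Ω)) ((↑) : s → Ω) ∧
      ∀ t ∈ T, IsSeparable (adjoin k ((C : Set Ω) ∪ s)) t := by
  classical
  set P : IntermediateField k Ω := perfectClosure k Ω with hP
  set M : IntermediateField P Ω := adjoin P (T : Set Ω) with hM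
  haveI : Algebra.EssFiniteType P M := essFiniteType_iff.mpr (fg_adjoin_finset T)
  obtain ⟨s₀, hs₀, hsep⟩ := exists_isTranscendenceBasis_and_isSeparable_of_perfectField P M
  set s : Finset Ω := s₀.image Subtype.val with hs
  have hsM : ∀ x ∈ s, x ∈ M := by
    intro x hx
    obtain ⟨y, -, rfl⟩ := Finset.mem_image.mp hx
    exact y.2
  have hims : Subtype.val '' (s₀ : Set M) = (s : Set Ω) := by
    rw [hs, Finset.coe_image]
  -- (1) algebraic independence over `P`, in `Ω`
  have hind : AlgebraicIndependent P ((↑) : s → Ω) := by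
    have he : ∀ x : s, ∃ y : s₀, ((y : M) : Ω) = (x : Ω) := fun x => by
      obtain ⟨y, hy, hyx⟩ := Finset.mem_image.mp x.2
      exact ⟨⟨y, hy⟩, hyx⟩
    choose e he using he
    have hinj : Function.Injective e := fun a b hab =>
      Subtype.ext (by rw [← he a, ← he b, hab])
    have h1 := (hs₀.1.comp e hinj).map' (f := M.val) fun a b h => Subtype.ext h
    convert h1 using 1
    funext x
    exact (he x).symm
  -- (2) every `t ∈ T` is separable over `k(P ∪ s)`
  have hsepΩ : ∀ t ∈ T, IsSeparable (adjoin k ((P : Set Ω) ∪ s)) t := by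
    intro t ht
    have htM : t ∈ M := subset_adjoin P _ (Finset.mem_coe.mpr ht)
    have h1 : IsSeparable (adjoin P (s₀ : Set M)) (⟨t, htM⟩ : M) :=
      Algebra.IsSeparable.isSeparable _ _
    have h2 : IsSeparable (adjoin P (s₀ : Set M)) t := by
      have hmin := minpoly.algebraMap_eq (A := adjoin P (s₀ : Set M))
        (algebraMap M Ω).injective (⟨t, htM⟩ : M)
      show (minpoly _ t).Separable
      have ht' : (algebraMap M Ω) ⟨t, htM⟩ = t := rfl
      rw [ht'] at hmin
      rw [hmin]
      exact h1
    have hPs : ∀ y : adjoin P (s₀ : Set M), ((y : M) : Ω) ∈ adjoin k ((P : Set Ω) ∪ s) := by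
      intro y
      have hy : ((y : M) : Ω) ∈ lift (adjoin P (s₀ : Set M)) := (mem_lift (y : M)).mpr y.2
      rw [lift_adjoin, hims] at hy
      have hres : (adjoin P (s : Set Ω)).restrictScalars k = adjoin k ((P : Set Ω) ∪ s) :=
        restrictScalars_adjoin k P _
      rw [← hres]
      exact hy
    let f : adjoin P (s₀ : Set M) →+* adjoin k ((P : Set Ω) ∪ s) :=
      { toFun := fun y => ⟨((y : M) : Ω), hPs y⟩
        map_one' := rfl
        map_mul' := fun _ _ => rfl
        map_zero' := rfl
        map_add' := fun _ _ => rfl }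
    exact isSeparable_of_ringHom_comp_eq f (RingHom.ext fun _ => rfl) h2
  have hsepΩ' : ∀ t ∈ T, ∃ S : Finset Ω, (S : Set Ω) ⊆ (P : Set Ω) ∪ s ∧
      IsSeparable (adjoin k (S : Set Ω)) t := fun t ht =>
    exists_finset_isSeparable_of_isSeparable_adjoin (hsepΩ t ht)
  choose S hS hSsep using hsepΩ'
  -- (3) every `x ∈ s` lies in `k(R)` for a finite `R ⊆ P ∪ T`
  have hmemΩ : ∀ x ∈ s, ∃ R : Finset Ω, (R : Set Ω) ⊆ (P : Set Ω) ∪ T ∧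
      x ∈ adjoin k (R : Set Ω) := by
    intro x hx
    have hxM : x ∈ M.restrictScalars k := (mem_restrictScalars k).mpr (hsM x hx)
    rw [hM, restrictScalars_adjoin] at hxM
    exact exists_finset_of_mem_adjoin hxM
  choose R hR hRmem using hmemΩ
  -- the finite set of constants
  let C : Finset Ω := (T.attach.biUnion fun t => (S t.1 t.2).filter (· ∈ P)) ∪
    (s.attach.biUnion fun x => (R x.1 x.2).filter (· ∈ P))
  have hCP : (C : Set Ω) ⊆ P := by
    intro c hc
    rcases Finset.mem_union.mp (Finset.mem_coe.mp hc) with hc | hc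
    · obtain ⟨t, -, hct⟩ := Finset.mem_biUnion.mp hc
      exact (Finset.mem_filter.mp hct).2
    · obtain ⟨x, -, hcx⟩ := Finset.mem_biUnion.mp hc
      exact (Finset.mem_filter.mp hcx).2
  have hSC : ∀ t (ht : t ∈ T), (S t ht : Set Ω) ⊆ (C : Set Ω) ∪ s := by
    intro t ht y hy
    rcases hS t ht hy with hyP | hys
    · left
      exact Finset.mem_coe.mpr (Finset.mem_union_left _ (Finset.mem_biUnion.mpr
        ⟨⟨t, ht⟩, Finset.mem_attach _ _, Finset.mem_filter.mpr ⟨Finset.mem_coe.mp hy, hyP⟩⟩))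
    · right
      exact hys
  have hRC : ∀ x (hx : x ∈ s), (R x hx : Set Ω) ⊆ (C : Set Ω) ∪ T := by
    intro x hx y hy
    rcases hR x hx hy with hyP | hyT
    · left
      exact Finset.mem_coe.mpr (Finset.mem_union_right _ (Finset.mem_biUnion.mpr
        ⟨⟨x, hx⟩, Finset.mem_attach _ _, Finset.mem_filter.mpr ⟨Finset.mem_coe.mp hy, hyP⟩⟩))
    · right
      exact hyT
  refine ⟨C, s, hCP, ?_, ?_, ?_⟩
  · intro x hx
    exact adjoin.mono k _ _ (hRC x hx) (hRmem x hx)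
  · have hle : adjoin k (C : Set Ω) ≤ P := adjoin_le_iff.mpr hCP
    exact hind.of_ringHom_of_comp_eq (inclusion hle) (RingHom.id Ω) (inclusion_injective hle)
      (RingHom.ext fun _ => rfl)
  · intro t ht
    exact isSeparable_of_le (adjoin.mono k _ _ (hSC t ht)) (hSsep t ht)

/-- **A finitely generated field extension becomes separably generated — hence formally smooth —
after a finite purely inseparable extension of the constants.** For `K/k` finitely generated
there are a finite purely inseparable extension `L/K`, and an intermediate field `l` of `L/k`,
finite and purely inseparable over `k`, with `L = lK` (`L` is generated over `K` by `l`), such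
that `L/l` is separably generated (there is a finite `s ⊆ L`, algebraically independent over
`l`, with `L` separable algebraic over `l(s)`); in particular `L` is formally smooth over `l`
(Mathlib's `Algebra.FormallySmooth.of_algebraicIndependent_of_isSeparable`). Construction: embed
`K` in an algebraic closure `Ω`, apply `exists_finset_separatingTranscendenceBasis` to generators
of `K/k`, and put `L = K(C)`, `l = k(C)`. This is "the classical theorem on the existence of a
separating transcendence basis" to which the height-zero case of inseparable local
uniformization reduces (Temkin 2013, proof of Thm. 4.1.1, p. 47). [folklore] -/
theorem exists_purelyInseparable_isSeparablyGenerated (k K : Type u) [Field k] [Field K]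
    [Algebra k K] (hfg : (⊤ : IntermediateField k K).FG) :
    ∃ (L : Type u) (_ : Field L) (_ : Algebra K L) (_ : Algebra k L) (_ : IsScalarTower k K L),
      FiniteDimensional K L ∧ IsPurelyInseparable K L ∧
      ∃ l : IntermediateField k L, FiniteDimensional k l ∧ IsPurelyInseparable k l ∧
        adjoin K (l : Set L) = ⊤ ∧
        (∃ s : Finset L, AlgebraicIndependent l ((↑) : s → L) ∧
          Algebra.IsSeparable (adjoin l (s : Set L)) L) ∧
        Algebra.FormallySmooth l L := by
  classical
  obtain ⟨T₀, hT₀⟩ := hfg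
  obtain ⟨q, hq⟩ := ExpChar.exists k
  haveI : ExpChar K q := expChar_of_injective_algebraMap (algebraMap k K).injective q
  let Ω := AlgebraicClosure K
  haveI : ExpChar Ω q := expChar_of_injective_algebraMap (algebraMap K Ω).injective q
  let φK : K →ₐ[k] Ω := IsScalarTower.toAlgHom k K Ω
  let T : Finset Ω := T₀.image φK
  obtain ⟨C, s, hCP, hsCT, hind, hsep⟩ := exists_finset_separatingTranscendenceBasis k Ω T
  -- the image of `K` is `k(T)`
  have hKT : Set.range (algebraMap K Ω) ⊆ adjoin k (T : Set Ω) := by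
    rintro _ ⟨x, rfl⟩
    have hx : x ∈ adjoin k (T₀ : Set K) := by
      rw [hT₀]
      exact mem_top
    have hx' : φK x ∈ (adjoin k (T₀ : Set K)).map φK := ⟨x, hx, rfl⟩
    rw [adjoin_map] at hx'
    have himg : φK '' (T₀ : Set K) = (T : Set Ω) := by
      simp only [T, Finset.coe_image]
    rw [himg] at hx'
    exact hx'
  -- `L = K(C)`
  let L₀ : IntermediateField K Ω := adjoin K (C : Set Ω)
  haveI : IsScalarTower k L₀ Ω := IsScalarTower.of_algebraMap_eq fun _ => rfl
  haveI : ExpChar L₀ q := expChar_of_injective_algebraMap (algebraMap K L₀).injective q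
  have hCL₀ : (C : Set Ω) ⊆ L₀ := subset_adjoin K _
  have hTL₀ : (T : Set Ω) ⊆ L₀ := by
    intro t ht
    simp only [T, Finset.coe_image] at ht
    obtain ⟨x, -, rfl⟩ := ht
    exact L₀.algebraMap_mem x
  have hCTL₀ : adjoin k ((C : Set Ω) ∪ T) ≤ L₀.restrictScalars k := by
    rw [adjoin_le_iff, coe_restrictScalars]
    exact Set.union_subset hCL₀ hTL₀
  have hsL₀ : (s : Set Ω) ⊆ L₀ := fun x hx => (mem_restrictScalars k).mp (hCTL₀ (hsCT hx))
  -- integrality of the constants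
  have hCint : ∀ x ∈ (C : Set Ω), IsIntegral k x := fun x hx => by
    have halg : IsAlgebraic k (⟨x, hCP hx⟩ : perfectClosure k Ω) :=
      Algebra.IsAlgebraic.isAlgebraic _
    exact isAlgebraic_iff_isIntegral.mp (isAlgebraic_iff.mp halg)
  -- `L/K` is finite purely inseparable
  have hfin : FiniteDimensional K L₀ :=
    finiteDimensional_adjoin fun x hx => (hCint x hx).tower_top
  have hpi : IsPurelyInseparable K L₀ := by
    refine (isPurelyInseparable_adjoin_iff_pow_mem K Ω q).mpr fun x hx => ?_
    obtain ⟨n, y, hy⟩ := (mem_perfectClosure_iff_pow_mem q).mp (hCP hx)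
    exact ⟨n, algebraMap k K y, by rw [← IsScalarTower.algebraMap_apply]; exact hy⟩
  -- `l = k(C)` inside `L`
  let C' : Finset L₀ := C.preimage Subtype.val Subtype.val_injective.injOn
  have hmemC' : ∀ {c : Ω} (hc : c ∈ (C : Set Ω)), (⟨c, hCL₀ hc⟩ : L₀) ∈ (C' : Set L₀) :=
    fun hc => Finset.mem_coe.mpr (Finset.mem_preimage.mpr (Finset.mem_coe.mp hc))
  let l : IntermediateField k L₀ := adjoin k (C' : Set L₀)
  have hlfin : FiniteDimensional k l := by
    refine finiteDimensional_adjoin fun x hx => ?_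
    have hx' : (x : Ω) ∈ C := Finset.mem_preimage.mp (Finset.mem_coe.mp hx)
    exact (isIntegral_algHom_iff (IsScalarTower.toAlgHom k L₀ Ω) (algebraMap L₀ Ω).injective).mp
      (hCint _ (Finset.mem_coe.mpr hx'))
  have hlpi : IsPurelyInseparable k l := by
    refine (isPurelyInseparable_adjoin_iff_pow_mem k L₀ q).mpr fun x hx => ?_
    have hx' : (x : Ω) ∈ C := Finset.mem_preimage.mp (Finset.mem_coe.mp hx)
    obtain ⟨n, y, hy⟩ := (mem_perfectClosure_iff_pow_mem q).mp (hCP (Finset.mem_coe.mpr hx'))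
    refine ⟨n, y, (algebraMap L₀ Ω).injective ?_⟩
    rw [← IsScalarTower.algebraMap_apply, map_pow]
    exact hy
  have hlK : adjoin K (l : Set L₀) = ⊤ := by
    apply lift_injective L₀
    rw [lift_adjoin, lift_top]
    refine le_antisymm (adjoin_le_iff.mpr ?_) (adjoin.mono K _ _ fun c hc => ?_)
    · rintro _ ⟨y, -, rfl⟩
      exact y.2
    · exact ⟨⟨c, hCL₀ hc⟩, subset_adjoin k _ (hmemC' hc), rfl⟩
  -- the separating transcendence basis inside `L`
  let s' : Finset L₀ := s.preimage Subtype.val Subtype.val_injective.injOn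
  have hind' : AlgebraicIndependent l ((↑) : s' → L₀) := by
    let e : s' → s := fun x => ⟨((x : L₀) : Ω), Finset.mem_preimage.mp x.2⟩
    have hinj : Function.Injective e := fun a b hab =>
      Subtype.ext (Subtype.ext (congrArg (fun y : s => (y : Ω)) hab))
    have h1 : AlgebraicIndependent (adjoin k (C : Set Ω)) (((↑) : s → Ω) ∘ e) := hind.comp e hinj
    have hlC : ∀ y : l, ((y : L₀) : Ω) ∈ adjoin k (C : Set Ω) := by
      intro y
      have hy : ((y : L₀) : Ω) ∈ l.map (IsScalarTower.toAlgHom k L₀ Ω) := ⟨y, y.2, rfl⟩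
      have himg : (IsScalarTower.toAlgHom k L₀ Ω) '' (C' : Set L₀) ⊆ (C : Set Ω) := by
        rintro _ ⟨z, hz, rfl⟩
        exact Finset.mem_coe.mpr (Finset.mem_preimage.mp (Finset.mem_coe.mp hz))
      have hmap : l.map (IsScalarTower.toAlgHom k L₀ Ω) ≤ adjoin k (C : Set Ω) := by
        simp only [l]
        rw [adjoin_map]
        exact adjoin.mono k _ _ himg
      exact hmap hy
    let f : l →+* adjoin k (C : Set Ω) :=
      { toFun := fun y => ⟨((y : L₀) : Ω), hlC y⟩
        map_one' := rfl
        map_mul' := fun _ _ => rfl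
        map_zero' := rfl
        map_add' := fun _ _ => rfl }
    have hf : Function.Injective f := fun a b hab =>
      Subtype.ext (Subtype.ext (congrArg (fun y : adjoin k (C : Set Ω) => (y : Ω)) hab))
    exact h1.of_ringHom_of_comp_eq f (algebraMap L₀ Ω) hf (RingHom.ext fun _ => rfl)
  -- separability of `L` over `l(s)`: first in `Ω` over `E₂ = k(C ∪ s)` ...
  have hsepL₂ : Algebra.IsSeparable (adjoin k ((C : Set Ω) ∪ s))
      (adjoin (adjoin k ((C : Set Ω) ∪ s)) ((C : Set Ω) ∪ T)) := by
    rw [isSeparable_adjoin_iff_isSeparable]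
    rintro x (hx | hx)
    · exact isSeparable_algebraMap (⟨x, subset_adjoin k _ (Or.inl hx)⟩ : adjoin k ((C : Set Ω) ∪ s))
    · exact hsep x (Finset.mem_coe.mp hx)
  have hL₀L₂ : ∀ x ∈ L₀, x ∈ adjoin (adjoin k ((C : Set Ω) ∪ s)) ((C : Set Ω) ∪ T) := by
    intro x hx
    have hle : (adjoin K (C : Set Ω)).toSubfield ≤
        (adjoin (adjoin k ((C : Set Ω) ∪ s)) ((C : Set Ω) ∪ T)).toSubfield := by
      rw [adjoin_toSubfield]
      refine Subfield.closure_le.mpr ?_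
      rintro y (⟨z, rfl⟩ | hy)
      · have h2 : adjoin k (T : Set Ω) ≤
            (adjoin (adjoin k ((C : Set Ω) ∪ s)) ((C : Set Ω) ∪ T)).restrictScalars k := by
          rw [adjoin_le_iff, coe_restrictScalars]
          exact fun t ht => subset_adjoin _ _ (Or.inr ht)
        exact (mem_restrictScalars k).mp (h2 (hKT ⟨z, rfl⟩))
      · exact subset_adjoin _ _ (Or.inl hy)
    exact hle hx
  have hsepAll : ∀ x ∈ L₀, IsSeparable (adjoin k ((C : Set Ω) ∪ s)) x := by
    intro x hx
    have h1 : IsSeparable (adjoin k ((C : Set Ω) ∪ s))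
        (⟨x, hL₀L₂ x hx⟩ : adjoin (adjoin k ((C : Set Ω) ∪ s)) ((C : Set Ω) ∪ T)) :=
      Algebra.IsSeparable.isSeparable _ _
    have hmin := minpoly.algebraMap_eq (A := adjoin k ((C : Set Ω) ∪ s))
      (algebraMap (adjoin (adjoin k ((C : Set Ω) ∪ s)) ((C : Set Ω) ∪ T)) Ω).injective
      ⟨x, hL₀L₂ x hx⟩
    have hx' : (algebraMap (adjoin (adjoin k ((C : Set Ω) ∪ s)) ((C : Set Ω) ∪ T)) Ω)
        ⟨x, hL₀L₂ x hx⟩ = x := rfl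
    rw [hx'] at hmin
    show (minpoly _ x).Separable
    rw [hmin]
    exact h1
  -- ... then moved into `L` over `l(s')`
  have hE₂L₀' : adjoin k ((C : Set Ω) ∪ s) ≤ L₀.restrictScalars k := by
    rw [adjoin_le_iff, coe_restrictScalars]
    exact Set.union_subset hCL₀ hsL₀
  have hE₂L₀ : ∀ {y : Ω}, y ∈ adjoin k ((C : Set Ω) ∪ s) → y ∈ L₀ := fun hy =>
    (mem_restrictScalars k).mp (hE₂L₀' hy)
  have hmemF : ∀ (y : Ω) (hy : y ∈ adjoin k ((C : Set Ω) ∪ s)),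
      (⟨y, hE₂L₀ hy⟩ : L₀) ∈ adjoin l (s' : Set L₀) := by
    intro y hy
    rw [← mem_restrictScalars k, restrictScalars_adjoin]
    have hsub : (C : Set Ω) ∪ s ⊆ (IsScalarTower.toAlgHom k L₀ Ω) '' ((l : Set L₀) ∪ s') := by
      rintro c (hc | hc)
      · exact ⟨⟨c, hCL₀ hc⟩, Or.inl (subset_adjoin k _ (hmemC' hc)), rfl⟩
      · exact ⟨⟨c, hsL₀ hc⟩,
          Or.inr (Finset.mem_coe.mpr (Finset.mem_preimage.mpr (Finset.mem_coe.mp hc))), rfl⟩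
    have hy' : y ∈ (adjoin k ((l : Set L₀) ∪ s')).map (IsScalarTower.toAlgHom k L₀ Ω) := by
      rw [adjoin_map]
      exact adjoin.mono k _ _ hsub hy
    obtain ⟨z, hz, hzy⟩ := hy'
    have hz' : z = ⟨y, hE₂L₀ hy⟩ := Subtype.ext hzy
    rwa [hz'] at hz
  let f₂ : adjoin k ((C : Set Ω) ∪ s) →+* adjoin l (s' : Set L₀) :=
    { toFun := fun y => ⟨⟨y, hE₂L₀ y.2⟩, hmemF y y.2⟩
      map_one' := rfl
      map_mul' := fun _ _ => rfl
      map_zero' := rfl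
      map_add' := fun _ _ => rfl }
  have hsepF : Algebra.IsSeparable (adjoin l (s' : Set L₀)) L₀ := by
    refine ⟨fun x => ?_⟩
    have h2 : IsSeparable (adjoin l (s' : Set L₀)) (x : Ω) :=
      isSeparable_of_ringHom_comp_eq f₂ (RingHom.ext fun _ => rfl) (hsepAll x x.2)
    have hmin := minpoly.algebraMap_eq (A := adjoin l (s' : Set L₀)) (algebraMap L₀ Ω).injective x
    show (minpoly _ x).Separable
    rw [← hmin]
    exact h2
  have hsmooth : Algebra.FormallySmooth l L₀ := by
    haveI : Algebra.IsSeparable (adjoin l (Set.range ((↑) : s' → L₀))) L₀ := by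
      rwa [Subtype.range_coe_subtype, Finset.setOf_mem]
    exact Algebra.FormallySmooth.of_algebraicIndependent_of_isSeparable hind'
  exact ⟨L₀, inferInstance, inferInstance, inferInstance, inferInstance, hfin, hpi, l, hlfin, hlpi,
    hlK, ⟨s', hind', hsepF⟩, hsmooth⟩

end Literature.AlgebraicGeometry.Resolution

end
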